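import Summits.AtomisticToContinuum.HydrodynamicLimit.Theses.TwoClocks
import Summits.AtomisticToContinuum.HydrodynamicLimit.Theses.ImplosionDichotomy
import Summits.AtomisticToContinuum.HydrodynamicLimit.Theorems.ImplosionDichotomyHsEosLowDensity
import Literature.Barriers.AtomisticToContinuum.HighMomentumCutoff
import HarnessLib

/-!
# The inherited dock inputs of line `explosion-limited-jamming` — what the tree already discharges

Crux `Summit.AtomisticToContinuum.HydrodynamicLimit.Theses.AntiMazurCoboundaries.KineticWindowGronwall`
(stmt-AtomisticToContinuum-9282, `= FluxGibbsianityLdDrude.KineticWindowGronwall` by `rfl`), skeleton line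
`explosion-limited-jamming`, registered stub `stub_inheritedDockInputs : InheritedDockInputs` — the bundle of the
five GIVEN children of the static-clamp relative-entropy dock that the line does not attack:

* `GaussianTailsAlongEvolution` — Gaussian velocity moments along the TRUE hard-sphere evolution on a small-density
  range, i.e. the catalogued OPEN hypothesis `Literature.Barriers.AtomisticToContinuum.HighMomentumCutoff σ`
  (Nachtergaele–Yau 2003, §2.3 Assumption II.1, transcribed; "no proof ... even in the classical case") for all
  `σ ∈ (0, σ₀)`;
* `TwoClocks.EnergyCurrentTails` (stmt-AtomisticToContinuum-9235, open-problem) — uniform integrability of the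
  cubic energy current in mean before the first shock;
* `TwoClocks.UniformLocalGibbsConcentration` (stmt-AtomisticToContinuum-14445, open, statics M) — the
  `η₀`-uniform exponential law of large numbers of the canonical local Gibbs laws;
* `TwoClocks.HsEosLowDensity` (stmt-AtomisticToContinuum-0768) — the low-density hard-sphere equation of state,
  CLOSED as proved (`Theorems.hsEosLowDensity_proof`, file `ImplosionDichotomyHsEosLowDensity`; the
  `ImplosionDichotomy` and `TwoClocks` decls have the same body);
* `TwoClocks.DiluteSelfConsistency` (stmt-AtomisticToContinuum-3091, open-problem; refuted iff
  `ImplosionDichotomy.DenseExcursion`).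

This file records, sorry-free, how far the tree gets TODAY: two of the five conjuncts are discharged —
`HsEosLowDensity` by the landed theorem `Theorems.hsEosLowDensity_proof`, and `EnergyCurrentTails` as a
COROLLARY of the first conjunct (`energyCurrentTails_of_gaussianTails`: pointwise
`‖v‖³ 𝟙{‖v‖ > M} ≤ δ e^{c‖v‖²}` for `M ≥ max 1 (6/(δc³))`, then
monotonicity and linearity of the lower integral against the `N`-uniform Gaussian moment bound on the horizon
`t + 1`; the Euler solution and the `t = 0` law of large numbers in the item's frame are not used — the cubic
twin of `Theorems.kineticEnergyTails_of_highMomentumCutoff`). Hence the registered helper stub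
`stub_inheritedDockInputsOfOpen : InheritedDockInputsOfOpen`,
`InheritedDockInputsOfOpen := GaussianTailsAlongEvolution → UniformLocalGibbsConcentration →
DiluteSelfConsistency → InheritedDockInputs`: the bundle is reduced to its three genuinely open members
(`HighMomentumCutoff` on a density range, 14445, 3091). `GaussianTailsAlongEvolution` and `InheritedDockInputs`
are re-declared verbatim from the skeleton `Cruxes/KineticWindowGronwall/Lines/explosion-limited-jamming.lean`.

References: B. Nachtergaele, H.-T. Yau, Comm. Math. Phys. 243 (2003), §2.3 Assumption II.1 and §7.2;
S. Olla, S. R. S. Varadhan, H.-T. Yau, Comm. Math. Phys. 155 (1993), §1 p. 525; D. Ruelle, *Statistical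
Mechanics: Rigorous Results* (1969), §3.4.
-/

noncomputable section

namespace Summit.AtomisticToContinuum.HydrodynamicLimit.Theorems.KineticWindowGronwallInheritedInputs

open MeasureTheory Set
open scoped ENNReal BigOperators
open Literature.MathematicalPhysics.KineticTheory (T3 V3 hsDiameter localGibbsLaw)
open Literature.Analysis.FluidPDE
open Summit.AtomisticToContinuum.HydrodynamicLimit.Theses.TwoClocks
  (EnergyCurrentTails UniformLocalGibbsConcentration HsEosLowDensity DiluteSelfConsistency)

/-! ## Statements (verbatim from the line skeleton) -/

/-- **GAUSSIAN VELOCITY MOMENTS ALONG THE TRUE EVOLUTION** on a small-density range: the tree's open hypothesis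
`Literature.Barriers.AtomisticToContinuum.HighMomentumCutoff σ` (Nachtergaele–Yau's Assumption II.1 transcribed to
hard spheres; Nachtergaele–Yau 2003, §2.3, "no proof ... even in the classical case") for every
`σ ∈ (0, σ₀)`. An OPEN named conjecture of this programme (obligation node: provable or refutable by name); body
verbatim from the line skeleton. -/
@[conjecture] def GaussianTailsAlongEvolution : Prop :=
  ∃ σ₀ : ℝ, 0 < σ₀ ∧ ∀ σ : ℝ, 0 < σ → σ < σ₀ → Literature.Barriers.AtomisticToContinuum.HighMomentumCutoff σ

/-- **THE DOCK INPUTS THE LINE INHERITS VERBATIM**: Gaussian velocity moments along the true law, cubic uniform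
integrability of the energy current (TwoClocks 9235), the `η₀`-uniform exponential LLN of canonical local Gibbs
states (14445), the low-density hard-sphere equation of state (0768) and dilute self-consistency of the tied
classical hs-Euler solutions (3091). OPEN (three of its five members are open board items / hypotheses); body
verbatim from the line skeleton (it is the signature of the registered stub `stub_inheritedDockInputs`). -/
@[conjecture] def InheritedDockInputs : Prop :=
  GaussianTailsAlongEvolution ∧ EnergyCurrentTails ∧ UniformLocalGibbsConcentration ∧ HsEosLowDensity ∧
    DiluteSelfConsistency

/-- **THE REDUCED BUNDLE** (signature of the registered helper stub `stub_inheritedDockInputsOfOpen`): the three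
conjuncts that are open on the board imply the whole bundle — `HsEosLowDensity` is a theorem of the tree and
`EnergyCurrentTails` follows from `GaussianTailsAlongEvolution`. -/
def InheritedDockInputsOfOpen : Prop :=
  GaussianTailsAlongEvolution → UniformLocalGibbsConcentration → DiluteSelfConsistency → InheritedDockInputs

/-! ## Sanity: the shared route decls are the same terms -/

/-- The `TwoClocks` and `ImplosionDichotomy` copies of the shared item 0768 have the same body. -/
example : HsEosLowDensity =
    Summit.AtomisticToContinuum.HydrodynamicLimit.Theses.ImplosionDichotomy.HsEosLowDensity := rfl

/-- The `TwoClocks` and `ImplosionDichotomy` copies of the shared item 3091 have the same body. -/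
example : DiluteSelfConsistency =
    Summit.AtomisticToContinuum.HydrodynamicLimit.Theses.ImplosionDichotomy.DiluteSelfConsistency := rfl

/-! ## Conjunct 2 from conjunct 1: Gaussian moments along the flow give cubic uniform integrability -/

/-- Gaussian domination of the cubic tail: for `c, δ > 0` and `r > max 1 (6/(δc³))`, `r³ ≤ δ exp(c r²)`
(from `x³/6 ≤ eˣ` at `x = c r²` and `r⁴ ≤ r⁶` for `r ≥ 1`). -/
theorem cube_le_mul_exp_sq_of_lt {c δ r : ℝ} (hc : 0 < c) (hδ : 0 < δ)
    (hr : max 1 (6 / (δ * c ^ 3)) < r) : r ^ 3 ≤ δ * Real.exp (c * r ^ 2) := by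
  have h1 : 1 < r := lt_of_le_of_lt (le_max_left _ _) hr
  have h2 : 6 / (δ * c ^ 3) < r := lt_of_le_of_lt (le_max_right _ _) hr
  have hdc : 0 < δ * c ^ 3 := by positivity
  have hkey : 6 < δ * c ^ 3 * r := by
    rw [div_lt_iff₀ hdc] at h2
    linarith
  have hr0 : 0 < r := by linarith
  have hexp : (c * r ^ 2) ^ 3 / 6 ≤ Real.exp (c * r ^ 2) := by
    have h := Real.pow_div_factorial_le_exp (x := c * r ^ 2) (by positivity) 3
    simpa [Nat.factorial] using h
  have hr46 : r ^ 4 ≤ r ^ 6 := pow_le_pow_right₀ h1.le (by norm_num)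
  calc r ^ 3 = 1 * r ^ 3 := (one_mul _).symm
    _ ≤ (δ * c ^ 3 * r / 6) * r ^ 3 := by gcongr; linarith
    _ = δ * c ^ 3 / 6 * r ^ 4 := by ring
    _ ≤ δ * c ^ 3 / 6 * r ^ 6 := by gcongr
    _ = δ * ((c * r ^ 2) ^ 3 / 6) := by ring
    _ ≤ δ * Real.exp (c * r ^ 2) := by gcongr

/-- Indicator form of `cube_le_mul_exp_sq_of_lt`: the cubic tail functional at the Gaussian cut-off
`max 1 (6/(δc³))` is below `δ e^{c‖v‖²}` everywhere. -/
theorem indicator_cube_le_mul_exp_sq {c δ : ℝ} (hc : 0 < c) (hδ : 0 < δ) (v : V3) :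
    Set.indicator {w : V3 | max 1 (6 / (δ * c ^ 3)) < ‖w‖} (fun w => ‖w‖ ^ 3) v ≤
      δ * Real.exp (c * ‖v‖ ^ 2) := by
  by_cases hv : max 1 (6 / (δ * c ^ 3)) < ‖v‖
  · rw [Set.indicator_of_mem (show v ∈ {w : V3 | max 1 (6 / (δ * c ^ 3)) < ‖w‖} from hv)]
    exact cube_le_mul_exp_sq_of_lt hc hδ hv
  · rw [Set.indicator_of_notMem (show v ∉ {w : V3 | max 1 (6 / (δ * c ^ 3)) < ‖w‖} from hv)]
    positivity

/-- **`GaussianTailsAlongEvolution ⇒ EnergyCurrentTails`** (conjunct 1 implies conjunct 2; the cubic twin of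
`Theorems.kineticEnergyTails_of_highMomentumCutoff`). Given the Gaussian moment bound for `σ ∈ (0, σ₀)`, the item
9235 holds with the same `σ₀`: at `(t, ε)` apply `HighMomentumCutoff σ` with horizon `t + 1 > 0` to get `c > 0`,
`C < ∞` with `∫ (N+1)⁻¹ ∑ᵢ exp(c ‖vᵢ(Φ_N(s) z)‖²) dλ^N ≤ C` for all `N` and `s ∈ [0, t + 1]`; put
`δ = ε / (C.toReal + 1)` and `M = max 1 (6/(δc³))`; pointwise `‖v‖³ 𝟙{‖v‖ > M} ≤ δ e^{c‖v‖²}`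
(`indicator_cube_le_mul_exp_sq`), so the lower integral is at most `δ · C ≤ ε` for every `N` (`N₀ = 0`). The
Euler solution and the `t = 0` law of large numbers in the frame of 9235 are not used. -/
theorem energyCurrentTails_of_gaussianTails (h : GaussianTailsAlongEvolution) : EnergyCurrentTails := by
  intro a₀ θ₀ u₀ ha hθ hu ha0 hθ0
  obtain ⟨σ₁, hσ₁, hH⟩ := h
  refine ⟨σ₁, hσ₁, fun σ hσp hσl T ρ θ u _hE Φ _hLLN t ht ε hε => ?_⟩
  obtain ⟨c, hc, C, hC, hb⟩ :=
    hH σ hσp hσl a₀ θ₀ u₀ ha hθ hu ha0 hθ0 (t + 1) (by linarith [ht.1]) Φ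
  set δ : ℝ := ε / (C.toReal + 1) with hδ
  have hC1 : 0 < C.toReal + 1 := by positivity
  have hδpos : 0 < δ := div_pos hε hC1
  have hδC : δ * C.toReal ≤ ε := by
    calc δ * C.toReal ≤ δ * (C.toReal + 1) :=
          mul_le_mul_of_nonneg_left (by linarith) hδpos.le
      _ = ε := by rw [hδ, div_mul_cancel₀ _ hC1.ne']
  refine ⟨max 1 (6 / (δ * c ^ 3)), 0, fun N _ s hs => ?_⟩
  have hsT : s ∈ Set.Icc 0 (t + 1) := ⟨hs.1, hs.2.trans (by linarith)⟩
  have hpt : ∀ z : Config (N + 1) (Fin 3) T3,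
      ENNReal.ofReal (((N : ℝ) + 1)⁻¹ * ∑ i : Fin (N + 1),
        Set.indicator {v : V3 | max 1 (6 / (δ * c ^ 3)) < ‖v‖} (fun v => ‖v‖ ^ 3)
          (((Φ N).flow s z i).2)) ≤
      ENNReal.ofReal δ *
        Literature.Barriers.AtomisticToContinuum.expVelocityMoment c ((Φ N).flow s z) := by
    intro z
    rw [Literature.Barriers.AtomisticToContinuum.expVelocityMoment_eq,
      ← ENNReal.ofReal_mul hδpos.le]
    refine ENNReal.ofReal_le_ofReal ?_
    calc ((N : ℝ) + 1)⁻¹ * ∑ i : Fin (N + 1),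
          Set.indicator {v : V3 | max 1 (6 / (δ * c ^ 3)) < ‖v‖} (fun v => ‖v‖ ^ 3)
            (((Φ N).flow s z i).2)
        ≤ ((N : ℝ) + 1)⁻¹ * ∑ i : Fin (N + 1), δ * Real.exp (c * ‖((Φ N).flow s z i).2‖ ^ 2) :=
          mul_le_mul_of_nonneg_left
            (Finset.sum_le_sum fun i _ => indicator_cube_le_mul_exp_sq hc hδpos _) (by positivity)
      _ = δ * (((N + 1 : ℕ) : ℝ)⁻¹ * ∑ i : Fin (N + 1),
            Real.exp (c * ‖((Φ N).flow s z i).2‖ ^ 2)) := by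
          rw [← Finset.mul_sum]
          push_cast
          ring
  calc ∫⁻ z, ENNReal.ofReal (((N : ℝ) + 1)⁻¹ * ∑ i : Fin (N + 1),
          Set.indicator {v : V3 | max 1 (6 / (δ * c ^ 3)) < ‖v‖} (fun v => ‖v‖ ^ 3)
            (((Φ N).flow s z i).2)) ∂(localGibbsLaw σ a₀ u₀ θ₀ N (Φ N))
      ≤ ∫⁻ z, ENNReal.ofReal δ *
          Literature.Barriers.AtomisticToContinuum.expVelocityMoment c ((Φ N).flow s z)
          ∂(localGibbsLaw σ a₀ u₀ θ₀ N (Φ N)) := lintegral_mono (hpt ·)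
    _ = ENNReal.ofReal δ * ∫⁻ z,
          Literature.Barriers.AtomisticToContinuum.expVelocityMoment c ((Φ N).flow s z)
          ∂(localGibbsLaw σ a₀ u₀ θ₀ N (Φ N)) :=
        lintegral_const_mul' _ _ ENNReal.ofReal_ne_top
    _ ≤ ENNReal.ofReal δ * C := mul_le_mul' le_rfl (hb N s hsT)
    _ = ENNReal.ofReal δ * ENNReal.ofReal C.toReal := by rw [ENNReal.ofReal_toReal hC.ne]
    _ = ENNReal.ofReal (δ * C.toReal) := (ENNReal.ofReal_mul hδpos.le).symm
    _ ≤ ENNReal.ofReal ε := ENNReal.ofReal_le_ofReal hδC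

/-! ## The reduction -/

/-- **The bundle from its open members.** `InheritedDockInputs` follows from `GaussianTailsAlongEvolution`,
`UniformLocalGibbsConcentration` (14445) and `DiluteSelfConsistency` (3091): conjunct 2 is
`energyCurrentTails_of_gaussianTails` of conjunct 1, and conjunct 4 (`TwoClocks.HsEosLowDensity`, stmt-0768,
closed as proved) is the tree's `Theorems.hsEosLowDensity_proof` — stated for the `ImplosionDichotomy` copy, which
has the same body (see the `example` above). Conversely the bundle hands back `h₁, h₃, h₅`, so over the current
tree `InheritedDockInputs` is equivalent to
`GaussianTailsAlongEvolution ∧ UniformLocalGibbsConcentration ∧ DiluteSelfConsistency`. -/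
theorem inheritedDockInputs_of_open (h₁ : GaussianTailsAlongEvolution) (h₃ : UniformLocalGibbsConcentration)
    (h₅ : DiluteSelfConsistency) : InheritedDockInputs :=
  ⟨h₁, energyCurrentTails_of_gaussianTails h₁, h₃,
    Summit.AtomisticToContinuum.HydrodynamicLimit.Theorems.hsEosLowDensity_proof, h₅⟩

/-- **STUB `stub_inheritedDockInputsOfOpen`** (helper stub of line `explosion-limited-jamming`, crux
`KineticWindowGronwall` stmt-AtomisticToContinuum-9282): the registered bundle `InheritedDockInputs` reduced to the
three conjuncts that are open on the board. -/
theorem stub_inheritedDockInputsOfOpen : InheritedDockInputsOfOpen :=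
  inheritedDockInputs_of_open

end Summit.AtomisticToContinuum.HydrodynamicLimit.Theorems.KineticWindowGronwallInheritedInputs

end
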